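import Summits.AtomisticToContinuum.Crystallization.Theorems.MinMeanCycleStackingLockBarlowEnergyIdentification
import Literature.MathematicalPhysics.StatisticalMechanics.LennardJonesClusters

/-!
# Crux `HcpLandscapeGap` (stmt-AtomisticToContinuum-12087), line `birth` — stub E1
# `stub_exactWindowEnergy`

STUB E1 of the skeleton `Cruxes/HcpLandscapeGap/Lines/birth.lean` (the energy bookkeeping step of
the exact-Barlow pricing): for `(a, h)` in the box `47/50 ≤ a ≤ 1`, `39/50·a ≤ h ≤ 17/20·a`, a
periodic Hägg word `s`, a rigid motion `w ↦ v + B w` and an injective finite family `x` of image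
points `x t = v + B (barlowPos a h s (m t) (i t) (j t))`, the finite Lennard-Jones energy dominates
the sum of the Barlow site energies: `∑_t barlowSiteEnergy V_LJ a h s (m t) ≤ 𝓔_LJ(x)`.

Mechanism.  On the box every pair of distinct stacking points is at squared distance
`≥ min (a², a²/3 + h², 4h²) ≥ 4/5` (`ExactWindowEnergy.le_dist_barlowPos_sq`: same layer `≥ a²`;
adjacent layers have label difference `±1`, and the lateral form
`3(2Δi + Δj ± 1)² + (3Δj ± 1)² ≥ 4` over `ℤ` gives lateral² `≥ a²/3`; layers `≥ 2` apart are
`≥ 2h` apart), hence `r⁶ ≥ (4/5)³ ≥ 1/2` and `V_LJ(r) = (u/12)(u - 2) ≤ 0`, `u = r⁻⁶ ≤ 2`.  So for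
each `t` the finite sum `siteEnergy V_LJ x t = ∑_{t' ≠ t} V_LJ(dist (x t) (x t'))` is (rigid
motions preserve distances, `t' ↦ (m t', i t', j t')` is injective) a partial sum of the summable
(`summable_lennardJones_barlowPos`) NONPOSITIVE family
`q ↦ V_LJ(dist (barlowPos (m t) (i t) (j t)) (barlowPos q))` over `ℤ³`, hence `≥` its `tsum`, which
by the in-layer translation `(i, j) ↦ (i - i t, j - j t)` and
`tsum_points_eq_tsum_barlowPos` / `tsum_points_eq_two_mul_barlowSiteEnergy` equals
`2 · barlowSiteEnergy V_LJ a h s (m t)`; summing over `t` and `two_mul_interactionEnergy` conclude.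
All [folklore].
-/

noncomputable section

namespace Summit.AtomisticToContinuum.Crystallization.Theorems.HcpLandscapeGapBirth

open Literature.MathematicalPhysics.StatisticalMechanics
open Summit.AtomisticToContinuum.Crystallization.Theorems

namespace ExactWindowEnergy

/-- `V_LJ(r) ≤ 0` as soon as `r⁶ ≥ 1/2`: `V_LJ(r) = (u/12)(u - 2)` with `u = r⁻⁶ ∈ [0, 2]`.
[folklore] -/
theorem lennardJones_nonpos_of_half_le {r : ℝ} (hr : 1 / 2 ≤ r ^ 6) : lennardJones r ≤ 0 := by
  unfold lennardJones
  have h0 : 0 ≤ (r⁻¹) ^ 6 := by rw [inv_pow]; positivity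
  have hu : (r⁻¹) ^ 6 ≤ 2 := by
    rw [inv_pow]
    exact inv_le_of_inv_le₀ (by norm_num) (by norm_num at hr ⊢; exact hr)
  have h12 : (r⁻¹) ^ 12 = ((r⁻¹) ^ 6) ^ 2 := by ring
  rw [h12]
  nlinarith [mul_nonneg h0 (sub_nonneg.2 hu)]

/-- The lateral integer form of two points in adjacent layers (label difference `e = ±1`):
`3(2u + w + e)² + (3w + e)² ≥ 4` (if `w = 0` the first square is that of an odd integer and the
second is `1`; otherwise `|3w + e| ≥ 2`). [folklore] -/
theorem four_le_lateralForm (u w e : ℤ) (he : e = 1 ∨ e = -1) :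
    4 ≤ 3 * (2 * u + w + e) ^ 2 + (3 * w + e) ^ 2 := by
  by_cases hw : w = 0
  · subst hw
    have h1 : 1 ≤ (2 * u + 0 + e) ^ 2 :=
      (one_le_sq_iff_one_le_abs _).2 (Int.one_le_abs (by omega))
    have h2 : 1 ≤ (3 * 0 + e) ^ 2 :=
      (one_le_sq_iff_one_le_abs _).2 (Int.one_le_abs (by omega))
    linarith
  · have h2 : 2 ≤ |3 * w + e| := by
      rcases le_or_gt 0 (3 * w + e) with h0 | h0
      · rw [abs_of_nonneg h0]; omega
      · rw [abs_of_neg h0]; omega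
    have h3 : (2 : ℤ) ^ 2 ≤ |3 * w + e| ^ 2 := pow_le_pow_left₀ (by norm_num) h2 2
    rw [sq_abs] at h3
    nlinarith [sq_nonneg (2 * u + w + e)]

/-- The lateral part of `dist_barlowPos_sq` as `a²/12` times the integer form (`t = √3`).
[folklore] -/
theorem lateral_sq_eq (a u w e t : ℝ) (ht : t ^ 2 = 3) :
    (a * (u + w / 2 + e / 2)) ^ 2 + (a * t / 2 * (w + e / 3)) ^ 2 =
      a ^ 2 / 12 * (3 * (2 * u + w + e) ^ 2 + (3 * w + e) ^ 2) := by
  linear_combination (a ^ 2 * (w + e / 3) ^ 2 / 4) * ht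

/-- For a Hägg sequence, adjacent layers have label difference `±1`. [folklore] -/
theorem haggLabel_sub_of_adjacent {s : ℤ → ℤ} (hs : IsHaggSeq s) {k k' : ℤ}
    (hk : k - k' = 1 ∨ k - k' = -1) :
    haggLabel s k - haggLabel s k' = 1 ∨ haggLabel s k - haggLabel s k' = -1 := by
  rcases hk with hk | hk
  · obtain rfl : k = k' + 1 := by omega
    rw [haggLabel_succ]
    rcases hs k' with h1 | h1 <;> rw [h1] <;> norm_num
  · obtain rfl : k' = k + 1 := by omega
    rw [haggLabel_succ]
    rcases hs k with h1 | h1 <;> rw [h1] <;> norm_num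

/-- **Pair distances in a Barlow stacking on the box.** For `47/50 ≤ a`, `39/50·a ≤ h` and a Hägg
sequence `s`, two distinct points of `barlowStacking a h s` are at squared distance `≥ 4/5`
(same layer: `≥ a² ≥ 0.88`; adjacent layers: `≥ a²/3 + h² ≥ 0.83`; layers `≥ 2` apart:
`≥ 4h² ≥ 2.1`). [folklore] -/
theorem le_dist_barlowPos_sq {a h : ℝ} {s : ℤ → ℤ} (ha : 47 / 50 ≤ a) (hh : 39 / 50 * a ≤ h)
    (hs : IsHaggSeq s) {k i j k' i' j' : ℤ} (hne : (k, i, j) ≠ (k', i', j')) :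
    4 / 5 ≤ dist (barlowPos a h s k i j) (barlowPos a h s k' i' j') ^ 2 := by
  have ha0 : 0 ≤ a := by linarith
  have ha2 : (47 / 50 : ℝ) * (47 / 50) ≤ a * a := mul_self_le_mul_self (by norm_num) ha
  have hh1 : (39 / 50 : ℝ) * (47 / 50) ≤ h := by nlinarith
  have hh2 : (39 / 50 * (47 / 50) : ℝ) * (39 / 50 * (47 / 50)) ≤ h * h :=
    mul_self_le_mul_self (by norm_num) hh1
  have hh3 : (39 / 50 * a : ℝ) * (39 / 50 * a) ≤ h * h :=
    mul_self_le_mul_self (by positivity) hh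
  rcases eq_or_ne k k' with rfl | hk
  · -- same layer
    have hij : (i, j) ≠ (i', j') := by
      intro h0
      apply hne
      obtain ⟨rfl, rfl⟩ := Prod.mk.inj h0
      rfl
    have h1 : a ≤ dist (barlowPos a h s k i j) (barlowPos a h s k i' j') :=
      le_dist_barlowPos_of_ne a h s ha0 hij
    have h2 : a * a ≤ dist (barlowPos a h s k i j) (barlowPos a h s k i' j') *
        dist (barlowPos a h s k i j) (barlowPos a h s k i' j') := mul_self_le_mul_self ha0 h1
    nlinarith
  · rw [dist_barlowPos_sq]
    by_cases hk1 : k - k' = 1 ∨ k - k' = -1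
    · -- adjacent layers
      have hL := haggLabel_sub_of_adjacent hs hk1
      have hform : (4 : ℤ) ≤ 3 * (2 * (i - i') + (j - j') + (haggLabel s k - haggLabel s k')) ^ 2 +
          (3 * (j - j') + (haggLabel s k - haggLabel s k')) ^ 2 :=
        four_le_lateralForm _ _ _ hL
      have hformR : (4 : ℝ) ≤ 3 * (2 * ((i : ℝ) - i') + ((j : ℝ) - j') +
          ((haggLabel s k : ℝ) - haggLabel s k')) ^ 2 +
          (3 * ((j : ℝ) - j') + ((haggLabel s k : ℝ) - haggLabel s k')) ^ 2 := by
        exact_mod_cast hform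
      have hkk : (k - k') ^ 2 = (1 : ℤ) := by
        rcases hk1 with h1 | h1 <;> rw [h1] <;> norm_num
      have hkkR : ((k : ℝ) - k') ^ 2 = 1 := by exact_mod_cast hkk
      have h3 : (√3 : ℝ) ^ 2 = 3 := Real.sq_sqrt (by norm_num)
      have hid := lateral_sq_eq a ((i : ℝ) - i') ((j : ℝ) - j')
        ((haggLabel s k : ℝ) - haggLabel s k') √3 h3
      have hZ : (((k : ℝ) - k') * h) ^ 2 = h ^ 2 := by rw [mul_pow, hkkR, one_mul]
      rw [hid, hZ]
      have h4 : a ^ 2 / 12 * 4 ≤ a ^ 2 / 12 * (3 * (2 * ((i : ℝ) - i') + ((j : ℝ) - j') +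
          ((haggLabel s k : ℝ) - haggLabel s k')) ^ 2 +
          (3 * ((j : ℝ) - j') + ((haggLabel s k : ℝ) - haggLabel s k')) ^ 2) :=
        mul_le_mul_of_nonneg_left hformR (by positivity)
      nlinarith
    · -- layers at least two apart
      have hk2 : 2 ≤ k - k' ∨ k - k' ≤ -2 := by omega
      have hkk : (4 : ℤ) ≤ (k - k') ^ 2 := by
        rcases hk2 with h2 | h2 <;> nlinarith
      have hkkR : (4 : ℝ) ≤ ((k : ℝ) - k') ^ 2 := by exact_mod_cast hkk
      have hZ : 4 * h ^ 2 ≤ (((k : ℝ) - k') * h) ^ 2 := by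
        rw [mul_pow]
        exact mul_le_mul_of_nonneg_right hkkR (sq_nonneg h)
      nlinarith [sq_nonneg (a * ((i - i') + (j - j') / 2 + (haggLabel s k - haggLabel s k') / 2)),
        sq_nonneg (a * √3 / 2 * ((j - j') + (haggLabel s k - haggLabel s k') / 3))]

/-- **All pair interactions in a Barlow stacking on the box are `≤ 0`**: for `47/50 ≤ a`,
`39/50·a ≤ h` and a Hägg sequence `s`, `V_LJ (dist p q) ≤ 0` for all stacking points `p, q`
(distinct points: `r² ≥ 4/5`, `r⁶ ≥ 64/125 ≥ 1/2`; equal points: `V_LJ 0 = 0`). [folklore] -/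
theorem lennardJones_dist_barlowPos_nonpos {a h : ℝ} {s : ℤ → ℤ} (ha : 47 / 50 ≤ a)
    (hh : 39 / 50 * a ≤ h) (hs : IsHaggSeq s) (k i j k' i' j' : ℤ) :
    lennardJones (dist (barlowPos a h s k i j) (barlowPos a h s k' i' j')) ≤ 0 := by
  by_cases hne : (k, i, j) = (k', i', j')
  · simp only [Prod.mk.injEq] at hne
    obtain ⟨rfl, rfl, rfl⟩ := hne
    rw [dist_self, lennardJones_zero]
  · refine lennardJones_nonpos_of_half_le ?_
    have h1 := le_dist_barlowPos_sq ha hh hs hne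
    have h2 : ((4 : ℝ) / 5) ^ 3 ≤
        (dist (barlowPos a h s k i j) (barlowPos a h s k' i' j') ^ 2) ^ 3 :=
      pow_le_pow_left₀ (by norm_num) h1 3
    calc (1 : ℝ) / 2 ≤ (4 / 5) ^ 3 := by norm_num
      _ ≤ _ := h2
      _ = _ := by ring

/-- **Per-site inequality.** In the setting of E1, for every index `t` the finite site energy
`siteEnergy V_LJ x t` dominates `2 · barlowSiteEnergy V_LJ a h s (m t)` (a finite partial sum of a
summable nonpositive family dominates its sum; the full punctured sum seen from
`barlowPos (m t) (i t) (j t)` is, by the in-layer translation `(i, j) ↦ (i - i t, j - j t)`, the one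
seen from `barlowPos (m t) 0 0`, i.e. `2 · barlowSiteEnergy`). [folklore] -/
theorem two_mul_barlowSiteEnergy_le_siteEnergy {a h : ℝ} {s : ℤ → ℤ} {p : ℕ}
    (ha : 47 / 50 ≤ a) (hh : 39 / 50 * a ≤ h) (hs : IsHaggSeq s) (hp : p ≠ 0)
    (hper : ∀ i, s (i + p) = s i)
    (B : EuclideanSpace ℝ (Fin 3) →ₗᵢ[ℝ] EuclideanSpace ℝ (Fin 3)) (v : EuclideanSpace ℝ (Fin 3))
    {n : ℕ} {x : Fin n → EuclideanSpace ℝ (Fin 3)} (hx : Function.Injective x)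
    (m i j : Fin n → ℤ) (hxt : ∀ t, x t = v + B (barlowPos a h s (m t) (i t) (j t))) (t : Fin n) :
    2 * barlowSiteEnergy lennardJones a h s (m t) ≤ siteEnergy lennardJones x t := by
  classical
  have ha0 : 0 < a := by linarith
  have hh0 : 0 < h := lt_of_lt_of_le (by positivity) hh
  -- the summable nonpositive family seen from `x₀ := barlowPos (m t) (i t) (j t)`
  obtain ⟨f, hf⟩ : ∃ f : ℤ × ℤ × ℤ → ℝ, f = fun q =>
      lennardJones (dist (barlowPos a h s (m t) (i t) (j t)) (barlowPos a h s q.1 q.2.1 q.2.2)) :=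
    ⟨_, rfl⟩
  have hfs : Summable f := hf ▸ summable_lennardJones_barlowPos ha0 hh0 ha0.ne' hh0.ne' hp hper _
  have hfnp : ∀ q, f q ≤ 0 := fun q => by
    rw [hf]
    exact lennardJones_dist_barlowPos_nonpos ha hh hs _ _ _ _ _ _
  -- (1) its sum is `2 · barlowSiteEnergy`
  have h1 : ∑' q, f q = 2 * barlowSiteEnergy lennardJones a h s (m t) := by
    rw [← tsum_points_eq_two_mul_barlowSiteEnergy ha0 hh0 ha0.ne' hh0.ne' hp hper (m t),
      tsum_points_eq_tsum_barlowPos ha0 hh0 ha0.ne' hh0.ne' hp hper (m t)]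
    let e : ℤ × ℤ × ℤ ≃ ℤ × ℤ × ℤ :=
      { toFun := fun q => (q.1, q.2.1 - i t, q.2.2 - j t)
        invFun := fun q => (q.1, q.2.1 + i t, q.2.2 + j t)
        left_inv := fun q => by simp
        right_inv := fun q => by simp }
    rw [← e.tsum_eq fun q : ℤ × ℤ × ℤ =>
      lennardJones (dist (barlowPos a h s (m t) 0 0) (barlowPos a h s q.1 q.2.1 q.2.2))]
    refine tsum_congr fun q => ?_
    rw [hf]
    show lennardJones (dist (barlowPos a h s (m t) (i t) (j t)) (barlowPos a h s q.1 q.2.1 q.2.2)) =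
      lennardJones (dist (barlowPos a h s (m t) 0 0)
        (barlowPos a h s q.1 (q.2.1 - i t) (q.2.2 - j t)))
    rw [dist_barlowPos_eq_norm_layerVec, dist_barlowPos_eq_norm_layerVec, sub_zero, sub_zero]
  -- (2) the site energy is a partial sum of it
  obtain ⟨ι, hι⟩ : ∃ ι : Fin n → ℤ × ℤ × ℤ, ι = fun t' => (m t', i t', j t') := ⟨_, rfl⟩
  have hιinj : Function.Injective ι := by
    intro t₁ t₂ h12
    rw [hι] at h12
    simp only [Prod.mk.injEq] at h12
    apply hx
    rw [hxt t₁, hxt t₂, h12.1, h12.2.1, h12.2.2]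
  have h2 : siteEnergy lennardJones x t = ∑ q ∈ (Finset.univ.erase t).image ι, f q := by
    rw [siteEnergy, Finset.sum_image fun t₁ _ t₂ _ h12 => hιinj h12]
    refine Finset.sum_congr rfl fun t' _ => ?_
    rw [hf, hι]
    show lennardJones (dist (x t) (x t')) = lennardJones
      (dist (barlowPos a h s (m t) (i t) (j t)) (barlowPos a h s (m t') (i t') (j t')))
    rw [hxt t, hxt t', dist_add_left, B.dist_map]
  -- (3) partial sums of a summable nonpositive family dominate its sum
  have h3 : ∑' q, f q ≤ ∑ q ∈ (Finset.univ.erase t).image ι, f q := by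
    have h4 := hfs.neg.sum_le_tsum ((Finset.univ.erase t).image ι)
      fun q _ => neg_nonneg.2 (hfnp q)
    rw [tsum_neg, Finset.sum_neg_distrib] at h4
    linarith
  rw [← h1, h2]
  exact h3

end ExactWindowEnergy

open ExactWindowEnergy in
/-- **Stub E1 — exact window energy ≥ sum of Barlow site energies.** For `(a, h)` in the
HcpDefectCounting box `47/50 ≤ a ≤ 1`, `39/50·a ≤ h ≤ 17/20·a`, a periodic Hägg word `s`, a rigid
motion `w ↦ v + B w` and an injective finite family `x` of image points with indices
`(m t, i t, j t)`: `∑_t barlowSiteEnergy V_LJ a h s (m t) ≤ 𝓔_LJ(x)` (sum over `t` of the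
per-site inequality `ExactWindowEnergy.two_mul_barlowSiteEnergy_le_siteEnergy`, and
`two_mul_interactionEnergy : 2 𝓔 = ∑_t siteEnergy`). [folklore] -/
theorem stub_exactWindowEnergy : (∀ (a h : ℝ), 47 / 50 ≤ a → a ≤ 1 → 39 / 50 * a ≤ h → h ≤ 17 / 20 * a → ∀ s : ℤ → ℤ, Literature.MathematicalPhysics.StatisticalMechanics.IsHaggSeq s → ∀ p : ℕ, p ≠ 0 → (∀ i : ℤ, s (i + p) = s i) → ∀ (B : EuclideanSpace ℝ (Fin 3) →ₗᵢ[ℝ] EuclideanSpace ℝ (Fin 3)) (v : EuclideanSpace ℝ (Fin 3)) (n : ℕ) (x : Fin n → EuclideanSpace ℝ (Fin 3)), Function.Injective x → ∀ (m i j : Fin n → ℤ), (∀ t : Fin n, x t = v + B (Literature.MathematicalPhysics.StatisticalMechanics.barlowPos a h s (m t) (i t) (j t))) → ∑ t : Fin n, Literature.MathematicalPhysics.StatisticalMechanics.barlowSiteEnergy Literature.MathematicalPhysics.StatisticalMechanics.lennardJones a h s (m t) ≤ Literature.MathematicalPhysics.StatisticalMechanics.interactionEnergy Literature.MathematicalPhysics.StatisticalMechanics.lennardJones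 x) := by
  intro a h ha _ hh _ s hs p hp hper B v n x hx m i j hxt
  have key : 2 * ∑ t, barlowSiteEnergy lennardJones a h s (m t) ≤
      ∑ t, siteEnergy lennardJones x t := by
    rw [Finset.mul_sum]
    exact Finset.sum_le_sum fun t _ =>
      two_mul_barlowSiteEnergy_le_siteEnergy ha hh hs hp hper B v hx m i j hxt t
  rw [← two_mul_interactionEnergy] at key
  linarith

end Summit.AtomisticToContinuum.Crystallization.Theorems.HcpLandscapeGapBirth

end
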